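import Literature.NumberTheory.Sieve.SmoothSaddlePointUniform
import HarnessLib

/-!
# `φ₂(α(x, y), y) ≍ (1 + log x/y) log x · log y` uniformly for `x ≥ y ≥ y₀`

Topic `Literature/NumberTheory/Sieve`; a PROVED tool file completing `SmoothSaddlePointUniform.lean`
(the LOWER bounds `φ₂(α, y) ≫ log x log y` and `φ₂(α, y) ≫ (log x)² log y/y`) with the matching UPPER
bound, so that Hildebrand–Tenenbaum's Lemma 4 (3.8) for `k = 2`,
`φ₂(α, y) ≍ (u log y)²/ū` (`u = log x/log y`, `ū = min(u, y/log y)`), equivalently Theorem 2 (2.5)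
"`φ₂(α, y) = (1 + log x/y) log x log y (1 + O(1/log(1+u) + 1/log y))`" up to absolute constants, holds
over the WHOLE range `x ≥ y ≥ y₀` (the tree's `saddlePhi₂_saddlePoint_le` covers `(log x)^3 ≤ y ≤ x`):

* `saddlePhi₂_le_card_div` — regime `σ log y ≤ 1`: `φ₂(σ, y) ≤ 3 π(y)/σ²`;
* `exists_saddlePhi₂_saddlePoint_le_uniform` — `φ₂(α(x,y), y) ≤ 108 (log x log y + (log x)² log y/y)`;
* `exists_saddlePhi₂_saddlePoint_two_sided_uniform` — `c (log x log y + (log x)² log y/y) ≤ φ₂(α, y)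
  ≤ C (log x log y + (log x)² log y/y)`.

Proof of the upper bound: if `α log y ≤ 1`, termwise `p^α/(p^α - 1)² ≤ 3/(α log p)²` gives
`φ₂ ≤ 3π(y)/α²`, and `log x = -φ₁(α, y) ≥ π(y)/(3α)` (`card_div_le_saddleSum`), `π(y) ≥ y/(4 log y)`;
if `α log y > 1`, the primes with `p^α ≥ 5/4` give `≤ 25 log y · Σ log p · p^{-α} ≤ 25 log y · log x`,
and the primes with `p^α < 5/4` (at most `y^{1/4} + 1`, each term `≤ (5/4)/α² ≤ (5/4) log² y`, and present
only when `α < 0.37`, whence `log x ≥ -φ₁(1/2, y) ≥ y^{1/2}/4`) give `≤ log x · log y`.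

## References

* [HildebrandTenenbaum1986] A. Hildebrand, G. Tenenbaum, Trans. AMS 296 (1986) 265–290, Thm 2 (2.5)
  and Lemma 4 (3.8) (held: `paper:doi-10-1090-s0002-9947-1986-0837811-1`, pp. 268, 273).
-/

noncomputable section

open Real Filter Finset MeasureTheory Chebyshev

namespace Literature.NumberTheory.Sieve

variable {σ : ℝ} {y : ℕ}

/-- Regime `σ log y ≤ 1`: **`φ₂(σ, y) ≤ 3 π(y)/σ²`** (termwise `p^σ ≤ e ≤ 3` and `p^σ - 1 ≥ σ log p`).
[cite: HildebrandTenenbaum1986, Lemma 4 (3.8), proof] -/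
theorem saddlePhi₂_le_card_div (hσ : 0 < σ) (hσy : σ * Real.log y ≤ 1) :
    saddlePhi₂ σ y ≤ 3 * #(Nat.primesLE y) / σ ^ 2 := by
  rw [saddlePhi₂_def, Finset.card_eq_sum_ones, Nat.cast_sum, Finset.mul_sum, Finset.sum_div]
  refine Finset.sum_le_sum fun p hp => ?_
  obtain ⟨h1, -⟩ := rpow_sub_one_bounds hp hσ hσy
  obtain ⟨hpy, hpp⟩ := Nat.mem_primesLE.1 hp
  have hp2 : (2 : ℝ) ≤ p := by exact_mod_cast hpp.two_le
  have hp0 : (0 : ℝ) < p := by linarith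
  have hlogp : 0 < Real.log p := Real.log_pos (by linarith)
  have hlogpy : Real.log p ≤ Real.log y := Real.log_le_log hp0 (by exact_mod_cast hpy)
  set D : ℝ := (p : ℝ) ^ σ - 1 with hDdef
  have hD : 0 < D := lt_of_lt_of_le (mul_pos hσ hlogp) h1
  -- `p^σ = exp(σ log p) ≤ e ≤ 3`
  have hP3 : (p : ℝ) ^ σ ≤ 3 := by
    rw [Real.rpow_def_of_pos hp0]
    have ht : Real.log p * σ ≤ 1 := by nlinarith
    calc Real.exp (Real.log p * σ) ≤ Real.exp 1 := Real.exp_le_exp.2 ht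
      _ ≤ 3 := by have := Real.exp_one_lt_d9; linarith
  push_cast
  rw [mul_one]
  calc Real.log p ^ 2 * ((p : ℝ) ^ σ / D ^ 2) ≤ Real.log p ^ 2 * (3 / (σ * Real.log p) ^ 2) := by
        apply mul_le_mul_of_nonneg_left _ (sq_nonneg _)
        calc (p : ℝ) ^ σ / D ^ 2 ≤ 3 / D ^ 2 := div_le_div_of_nonneg_right hP3 (sq_nonneg _)
          _ ≤ 3 / (σ * Real.log p) ^ 2 := by
              apply div_le_div_of_nonneg_left (by norm_num) (by positivity)
              exact pow_le_pow_left₀ (by positivity) h1 2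
    _ = 3 / σ ^ 2 := by field_simp

set_option maxHeartbeats 400000 in
/-- **`φ₂(α(x, y), y) ≤ 108 (log x log y + (log x)² log y/y)` uniformly for `x ≥ y ≥ y₀`** — the upper
half of Hildebrand–Tenenbaum's `φ₂(α, y) ≍ (u log y)²/ū` [Lemma 4 (3.8), `k = 2`; Thm 2 (2.5)] over the
whole range (regimes `α log y ≤ 1` and `α log y > 1` as in the module docstring).
[cite: HildebrandTenenbaum1986, Lemma 4 (3.8)] -/
theorem exists_saddlePhi₂_saddlePoint_le_uniform :
    ∃ y₀ : ℕ, 2 ≤ y₀ ∧ ∀ (x : ℝ) (y : ℕ), y₀ ≤ y → (y : ℝ) ≤ x →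
      saddlePhi₂ (saddlePoint x y) y ≤
        108 * (Real.log x * Real.log y + Real.log x ^ 2 * Real.log y / y) := by
  obtain ⟨y₁, hy₁2, hπ⟩ := exists_card_primesLE_ge
  obtain ⟨t₁, ht₁2, hθ⟩ := exists_theta_sub_theta_sqrt_ge
  obtain ⟨Y, hY1, hY⟩ := exists_log_le_mul_rpow (κ := 1 / 10) (ε := 1 / 4) (by norm_num) (by norm_num)
  refine ⟨max (max y₁ ⌈t₁⌉₊) (max ⌈Y⌉₊ 3), le_trans hy₁2 ((le_max_left _ _).trans (le_max_left _ _)),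
    fun x y hy hyx => ?_⟩
  have hy₁ : y₁ ≤ y := le_trans ((le_max_left _ _).trans (le_max_left _ _)) hy
  have hyt : t₁ ≤ y := le_trans (Nat.le_ceil t₁)
    (by exact_mod_cast le_trans ((le_max_right _ _).trans (le_max_left _ _)) hy)
  have hyY : Y ≤ y := le_trans (Nat.le_ceil Y)
    (by exact_mod_cast le_trans ((le_max_left _ _).trans (le_max_right _ _)) hy)
  have hy3 : 3 ≤ y := le_trans ((le_max_right _ _).trans (le_max_right _ _)) hy
  have hy2 : 2 ≤ y := le_trans (by norm_num) hy3
  have hy1 : (1 : ℝ) < y := by exact_mod_cast lt_of_lt_of_le (by norm_num) hy3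
  have hy0 : (0 : ℝ) < y := by linarith
  have hx1 : 1 < x := by linarith
  have hℓ : 0 < Real.log y := Real.log_pos hy1
  have hL : 0 < Real.log x := Real.log_pos hx1
  have hℓL : Real.log y ≤ Real.log x := Real.log_le_log hy0 hyx
  set ℓ : ℝ := Real.log y with hℓdef
  set L : ℝ := Real.log x with hLdef
  set α : ℝ := saddlePoint x y with hα
  have hα0 : 0 < α := saddlePoint_pos hx1 hy2
  have hsum : saddleSum α y = L := saddleSum_saddlePoint hx1 hy2
  have hLℓ0 : 0 ≤ L * ℓ := by positivity
  have hL2 : 0 ≤ L ^ 2 * ℓ / y := by positivity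
  by_cases hA : α * ℓ ≤ 1
  · -- regime `α log y ≤ 1`: `φ₂ ≤ 3π/α² ≤ 27 L²/π ≤ 108 L² ℓ/y`
    have h1 := saddlePhi₂_le_card_div hα0 hA
    have h2 := card_div_le_saddleSum hα0 hA
    rw [hsum] at h2
    have h3 := hπ y hy₁
    set P : ℝ := (#(Nat.primesLE y) : ℝ) with hP
    have hP0 : 0 < P := lt_of_lt_of_le (by positivity) h3
    -- `1/α ≤ 3L/P`
    have h4 : 1 / α ≤ 3 * L / P := by
      rw [div_le_div_iff₀ hα0 hP0]
      rw [div_le_iff₀ (by positivity)] at h2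
      linarith
    calc saddlePhi₂ α y ≤ 3 * P / α ^ 2 := h1
      _ = 3 * P * (1 / α) ^ 2 := by field_simp
      _ ≤ 3 * P * (3 * L / P) ^ 2 := by gcongr
      _ = 27 * L ^ 2 / P := by field_simp; ring
      _ ≤ 27 * L ^ 2 / (y / (4 * ℓ)) := div_le_div_of_nonneg_left (by positivity) (by positivity) h3
      _ = 108 * (L ^ 2 * ℓ / y) := by field_simp; ring
      _ ≤ 108 * (L * ℓ + L ^ 2 * ℓ / y) := by nlinarith
  · -- regime `α log y > 1`
    push Not at hA
    have h1α : 1 / α ≤ ℓ := by rw [div_le_iff₀ hα0]; linarith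
    -- split at `p^α ≥ 5/4`
    rw [saddlePhi₂_def, ← Finset.sum_filter_add_sum_filter_not (Nat.primesLE y)
      (fun p : ℕ => (5 : ℝ) / 4 ≤ (p : ℝ) ^ α)]
    -- the primes with `p^α ≥ 5/4`: `≤ 25 ℓ Σ log p · p^{-α} ≤ 25 ℓ L`
    have hG : ∑ p ∈ (Nat.primesLE y).filter (fun p : ℕ => (5 : ℝ) / 4 ≤ (p : ℝ) ^ α),
        Real.log p ^ 2 * ((p : ℝ) ^ α / ((p : ℝ) ^ α - 1) ^ 2) ≤ 25 * (L * ℓ) := by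
      have hT := sum_primesLE_log_mul_rpow_le_saddleSum hα0 y
      rw [hsum] at hT
      calc ∑ p ∈ (Nat.primesLE y).filter (fun p : ℕ => (5 : ℝ) / 4 ≤ (p : ℝ) ^ α),
            Real.log p ^ 2 * ((p : ℝ) ^ α / ((p : ℝ) ^ α - 1) ^ 2)
          ≤ ∑ p ∈ (Nat.primesLE y).filter (fun p : ℕ => (5 : ℝ) / 4 ≤ (p : ℝ) ^ α),
            25 * ℓ * (Real.log p * (p : ℝ) ^ (-α)) := by
            refine Finset.sum_le_sum fun p hp => ?_
            rw [Finset.mem_filter] at hp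
            obtain ⟨hp, hP⟩ := hp
            obtain ⟨hpy, hpp⟩ := Nat.mem_primesLE.1 hp
            have hp2 : (2 : ℝ) ≤ p := by exact_mod_cast hpp.two_le
            have hp0 : (0 : ℝ) < p := by linarith
            have hlogp : 0 ≤ Real.log p := Real.log_nonneg (by linarith)
            have hlogpy : Real.log p ≤ ℓ := Real.log_le_log hp0 (by exact_mod_cast hpy)
            set P : ℝ := (p : ℝ) ^ α with hPdef
            have hP0 : 0 < P := Real.rpow_pos_of_pos hp0 α
            have hD : P / 5 ≤ P - 1 := by linarith
            have hD0 : 0 < P - 1 := by linarith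
            have hkey : P / (P - 1) ^ 2 ≤ 25 * P⁻¹ := by
              calc P / (P - 1) ^ 2 ≤ P / (P / 5) ^ 2 := by
                    apply div_le_div_of_nonneg_left hP0.le (by positivity)
                    exact pow_le_pow_left₀ (by positivity) hD 2
                _ = 25 * P⁻¹ := by field_simp; ring
            rw [Real.rpow_neg hp0.le, ← hPdef]
            calc Real.log p ^ 2 * (P / (P - 1) ^ 2) ≤ Real.log p ^ 2 * (25 * P⁻¹) :=
                  mul_le_mul_of_nonneg_left hkey (sq_nonneg _)
              _ = 25 * Real.log p * (Real.log p * P⁻¹) := by ring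
              _ ≤ 25 * ℓ * (Real.log p * P⁻¹) := by
                  apply mul_le_mul_of_nonneg_right _ (by positivity)
                  linarith
        _ ≤ ∑ p ∈ Nat.primesLE y, 25 * ℓ * (Real.log p * (p : ℝ) ^ (-α)) := by
            refine Finset.sum_le_sum_of_subset_of_nonneg (Finset.filter_subset _ _) fun p hp _ => ?_
            have hp2 : (2 : ℝ) ≤ p := by exact_mod_cast (Nat.prime_of_mem_primesLE hp).two_le
            have : 0 ≤ (p : ℝ) ^ (-α) := Real.rpow_nonneg (by linarith) _
            have : 0 ≤ Real.log p := Real.log_nonneg (by linarith)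
            positivity
        _ = 25 * ℓ * ∑ p ∈ Nat.primesLE y, Real.log p * (p : ℝ) ^ (-α) := by rw [Finset.mul_sum]
        _ ≤ 25 * ℓ * L := mul_le_mul_of_nonneg_left hT (by positivity)
        _ = 25 * (L * ℓ) := by ring
    -- the primes with `p^α < 5/4`: `≤ L ℓ`
    have hB : ∑ p ∈ (Nat.primesLE y).filter (fun p : ℕ => ¬ ((5 : ℝ) / 4 ≤ (p : ℝ) ^ α)),
        Real.log p ^ 2 * ((p : ℝ) ^ α / ((p : ℝ) ^ α - 1) ^ 2) ≤ L * ℓ := by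
      set B := (Nat.primesLE y).filter (fun p : ℕ => ¬ ((5 : ℝ) / 4 ≤ (p : ℝ) ^ α)) with hBdef
      rcases B.eq_empty_or_nonempty with hBe | ⟨q, hq⟩
      · rw [hBe, Finset.sum_empty]; exact hLℓ0
      -- `α < 0.37`, hence `α < 1/2` and `L ≥ -φ₁(1/2, y) ≥ √y/4`
      have hα37 : α < 0.37 := by
        rw [hBdef, Finset.mem_filter, not_le] at hq
        obtain ⟨hq, hqα⟩ := hq
        have hq2 : (2 : ℝ) ≤ q := by exact_mod_cast (Nat.prime_of_mem_primesLE hq).two_le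
        have h2α : (2 : ℝ) ^ α < 5 / 4 :=
          lt_of_le_of_lt (Real.rpow_le_rpow (by norm_num) hq2 hα0.le) hqα
        have h3 : α * Real.log 2 < Real.log (5 / 4) := by
          have := Real.log_lt_log (Real.rpow_pos_of_pos two_pos α) h2α
          rwa [Real.log_rpow two_pos] at this
        have h4 : Real.log (5 / 4 : ℝ) ≤ 1 / 4 := by
          have := Real.log_le_sub_one_of_pos (by norm_num : (0 : ℝ) < 5 / 4); linarith
        have hl2 := Real.log_two_gt_d9
        nlinarith
      have hLsqrt : Real.sqrt y / 4 ≤ L := by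
        -- `L = -φ₁(α) ≥ -φ₁(1/2) ≥ Σ log p · p^{-1/2} ≥ y^{-1/2} (θ(y) - θ(√y)) ≥ √y/4`
        have h1 : saddleSum (1 / 2) y ≤ saddleSum α y :=
          saddleSum_antitoneOn hα0 (by norm_num : (0 : ℝ) < 1 / 2) (by linarith)
        rw [hsum] at h1
        have h2 := sum_primesLE_log_mul_rpow_le_saddleSum (by norm_num : (0 : ℝ) < 1 / 2) y
        have hsy : Real.sqrt y ≤ y := Real.sqrt_le_iff.mpr ⟨hy0.le, by nlinarith⟩
        have hsum' := theta_sub_theta_eq_sum_filter (A := Real.sqrt y) (B := (y : ℝ)) (Real.sqrt_nonneg _) hsy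
        rw [Nat.floor_natCast] at hsum'
        have hθy := hθ y hyt
        have hs0 : 0 < Real.sqrt y := Real.sqrt_pos.2 hy0
        -- `Σ_{p ≤ y} log p · p^{-1/2} ≥ Σ_{√y < p ≤ y} log p · y^{-1/2}`
        have h3 : (Real.sqrt y)⁻¹ * (θ y - θ (Real.sqrt y)) ≤
            ∑ p ∈ Nat.primesLE y, Real.log p * (p : ℝ) ^ (-(1 / 2 : ℝ)) := by
          rw [hsum', Finset.mul_sum]
          calc ∑ p ∈ (Nat.primesLE y).filter (fun p : ℕ => Real.sqrt y < (p : ℝ)),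
                (Real.sqrt y)⁻¹ * Real.log p
              ≤ ∑ p ∈ (Nat.primesLE y).filter (fun p : ℕ => Real.sqrt y < (p : ℝ)),
                Real.log p * (p : ℝ) ^ (-(1 / 2 : ℝ)) := by
                refine Finset.sum_le_sum fun p hp => ?_
                rw [Finset.mem_filter, Nat.mem_primesLE] at hp
                obtain ⟨⟨hpy, hpp⟩, -⟩ := hp
                have hp2 : (2 : ℝ) ≤ p := by exact_mod_cast hpp.two_le
                have hp0 : (0 : ℝ) < p := by linarith
                have hlogp : 0 ≤ Real.log p := Real.log_nonneg (by linarith)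
                -- `p^{-1/2} ≥ y^{-1/2} = 1/√y`
                have hpow : (Real.sqrt y)⁻¹ ≤ (p : ℝ) ^ (-(1 / 2 : ℝ)) := by
                  rw [Real.sqrt_eq_rpow, ← Real.rpow_neg hy0.le]
                  exact Real.rpow_le_rpow_of_nonpos hp0 (by exact_mod_cast hpy) (by norm_num)
                calc (Real.sqrt y)⁻¹ * Real.log p = Real.log p * (Real.sqrt y)⁻¹ := mul_comm _ _
                  _ ≤ Real.log p * (p : ℝ) ^ (-(1 / 2 : ℝ)) := mul_le_mul_of_nonneg_left hpow hlogp
            _ ≤ ∑ p ∈ Nat.primesLE y, Real.log p * (p : ℝ) ^ (-(1 / 2 : ℝ)) := by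
                refine Finset.sum_le_sum_of_subset_of_nonneg (Finset.filter_subset _ _) fun p hp _ => ?_
                have hp2 : (2 : ℝ) ≤ p := by exact_mod_cast (Nat.prime_of_mem_primesLE hp).two_le
                have : 0 ≤ (p : ℝ) ^ (-(1 / 2 : ℝ)) := Real.rpow_nonneg (by linarith) _
                have : 0 ≤ Real.log p := Real.log_nonneg (by linarith)
                positivity
        have h4 : Real.sqrt y / 4 ≤ (Real.sqrt y)⁻¹ * (θ y - θ (Real.sqrt y)) := by
          rw [inv_mul_eq_div, le_div_iff₀ hs0]
          calc Real.sqrt y / 4 * Real.sqrt y = y / 4 := by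
                rw [div_mul_eq_mul_div, Real.mul_self_sqrt hy0.le]
            _ ≤ θ y - θ (Real.sqrt y) := hθy
        linarith
      -- each term `≤ (5/4)/α² ≤ (5/4) ℓ²`
      have hterm : ∀ p ∈ B, Real.log p ^ 2 * ((p : ℝ) ^ α / ((p : ℝ) ^ α - 1) ^ 2) ≤ 5 / 4 * ℓ ^ 2 := by
        intro p hp
        rw [hBdef, Finset.mem_filter, not_le] at hp
        obtain ⟨hp, hpα⟩ := hp
        have hp2 : (2 : ℝ) ≤ p := by exact_mod_cast (Nat.prime_of_mem_primesLE hp).two_le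
        have hp0 : (0 : ℝ) < p := by linarith
        have hlogp : 0 < Real.log p := Real.log_pos (by linarith)
        have hD : α * Real.log p ≤ (p : ℝ) ^ α - 1 := by
          rw [Real.rpow_def_of_pos hp0]
          have := Real.add_one_le_exp (Real.log p * α)
          nlinarith
        have hD0 : 0 < (p : ℝ) ^ α - 1 := lt_of_lt_of_le (mul_pos hα0 hlogp) hD
        calc Real.log p ^ 2 * ((p : ℝ) ^ α / ((p : ℝ) ^ α - 1) ^ 2)
            ≤ Real.log p ^ 2 * ((5 / 4) / (α * Real.log p) ^ 2) := by
              apply mul_le_mul_of_nonneg_left _ (sq_nonneg _)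
              calc (p : ℝ) ^ α / ((p : ℝ) ^ α - 1) ^ 2 ≤ (5 / 4) / ((p : ℝ) ^ α - 1) ^ 2 :=
                    div_le_div_of_nonneg_right hpα.le (sq_nonneg _)
                _ ≤ (5 / 4) / (α * Real.log p) ^ 2 := by
                    apply div_le_div_of_nonneg_left (by norm_num) (by positivity)
                    exact pow_le_pow_left₀ (by positivity) hD 2
          _ = 5 / 4 * (1 / α) ^ 2 := by field_simp
          _ ≤ 5 / 4 * ℓ ^ 2 := by gcongr
      -- `#B ≤ y^{1/4} + 1`
      have hcard : (#B : ℝ) ≤ (y : ℝ) ^ (1 / 4 : ℝ) + 1 := by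
        set N : ℝ := (5 / 4 : ℝ) ^ (1 / α) with hN
        have hN0 : 0 ≤ N := Real.rpow_nonneg (by norm_num) _
        have hBsub : B ⊆ Finset.range (⌊N⌋₊ + 1) := by
          intro p hp
          rw [hBdef, Finset.mem_filter, not_le] at hp
          obtain ⟨-, hpσ⟩ := hp
          have hp0 : (0 : ℝ) ≤ p := Nat.cast_nonneg p
          rw [Finset.mem_range, Nat.lt_add_one_iff, Nat.le_floor_iff hN0]
          by_contra hcon
          push Not at hcon
          have : N ^ α ≤ (p : ℝ) ^ α := Real.rpow_le_rpow hN0 hcon.le hα0.le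
          rw [hN, ← Real.rpow_mul (by norm_num), one_div_mul_cancel hα0.ne', Real.rpow_one] at this
          linarith
        have h1 : #B ≤ ⌊N⌋₊ + 1 := le_trans (Finset.card_le_card hBsub) (by simp)
        have h2 : (#B : ℝ) ≤ N + 1 := by
          calc (#B : ℝ) ≤ ((⌊N⌋₊ + 1 : ℕ) : ℝ) := by exact_mod_cast h1
            _ = ⌊N⌋₊ + 1 := by push_cast; ring
            _ ≤ N + 1 := by linarith [Nat.floor_le hN0]
        have h3 : N ≤ (y : ℝ) ^ (1 / 4 : ℝ) := by
          calc N ≤ (5 / 4 : ℝ) ^ ℓ := Real.rpow_le_rpow_of_exponent_le (by norm_num) h1α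
            _ = Real.exp (Real.log (5 / 4) * ℓ) := by rw [Real.rpow_def_of_pos (by norm_num)]
            _ ≤ Real.exp (Real.log y * (1 / 4)) := by
                rw [Real.exp_le_exp]
                have h4 : Real.log (5 / 4 : ℝ) ≤ 1 / 4 := by
                  have := Real.log_le_sub_one_of_pos (by norm_num : (0 : ℝ) < 5 / 4); linarith
                rw [← hℓdef]; nlinarith
            _ = (y : ℝ) ^ (1 / 4 : ℝ) := by rw [Real.rpow_def_of_pos hy0]
        linarith
      -- assemble: `Σ_B ≤ (y^{1/4} + 1)(5/4)ℓ² ≤ (5/2) y^{1/4} ℓ · ℓ ≤ (√y/4) ℓ ≤ L ℓ` (`10 ℓ ≤ y^{1/4}`)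
      have hy14 : 1 ≤ (y : ℝ) ^ (1 / 4 : ℝ) := Real.one_le_rpow hy1.le (by norm_num)
      have hlogy_le : ℓ ≤ 1 / 10 * (y : ℝ) ^ (1 / 4 : ℝ) := hY y hyY
      have hsqrt : (y : ℝ) ^ (1 / 4 : ℝ) * (y : ℝ) ^ (1 / 4 : ℝ) = Real.sqrt y := by
        rw [← Real.rpow_add hy0, Real.sqrt_eq_rpow]; norm_num
      calc ∑ p ∈ B, Real.log p ^ 2 * ((p : ℝ) ^ α / ((p : ℝ) ^ α - 1) ^ 2)
          ≤ ∑ p ∈ B, 5 / 4 * ℓ ^ 2 := Finset.sum_le_sum hterm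
        _ = #B * (5 / 4 * ℓ ^ 2) := by rw [Finset.sum_const, nsmul_eq_mul]
        _ ≤ ((y : ℝ) ^ (1 / 4 : ℝ) + 1) * (5 / 4 * ℓ ^ 2) := mul_le_mul_of_nonneg_right hcard (by positivity)
        _ ≤ (2 * (y : ℝ) ^ (1 / 4 : ℝ)) * (5 / 4 * ℓ ^ 2) := by gcongr; linarith
        _ = 5 / 2 * ((y : ℝ) ^ (1 / 4 : ℝ) * ℓ) * ℓ := by ring
        _ ≤ 5 / 2 * ((y : ℝ) ^ (1 / 4 : ℝ) * (1 / 10 * (y : ℝ) ^ (1 / 4 : ℝ))) * ℓ := by gcongr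
        _ = Real.sqrt y / 4 * ℓ := by rw [← hsqrt]; ring
        _ ≤ L * ℓ := mul_le_mul_of_nonneg_right hLsqrt hℓ.le
    calc _ ≤ 25 * (L * ℓ) + L * ℓ := add_le_add hG hB
      _ ≤ 108 * (L * ℓ + L ^ 2 * ℓ / y) := by nlinarith

/-- **`φ₂(α(x, y), y) ≍ log x log y + (log x)² log y/y`, i.e. `≍ (1 + log x/y) log x log y`, uniformly
for `x ≥ y ≥ y₀`** — Hildebrand–Tenenbaum's Lemma 4 (3.8) for `k = 2` (`φ₂(α, y) ≍ (u log y)²/ū`,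
`ū = min(u, y/log y)`) and Theorem 2 (2.5) up to absolute constants, over the whole range: the lower half
from `le_saddlePhi₂_saddlePoint_uniform` and `sq_log_div_le_saddlePhi₂_saddlePoint`
(`SmoothSaddlePointUniform`), the upper half from `exists_saddlePhi₂_saddlePoint_le_uniform`.
[cite: HildebrandTenenbaum1986, Thm 2 (2.5) and Lemma 4 (3.8)] -/
theorem exists_saddlePhi₂_saddlePoint_two_sided_uniform :
    ∃ c C : ℝ, ∃ y₀ : ℕ, 0 < c ∧ 0 < C ∧ 2 ≤ y₀ ∧ ∀ (x : ℝ) (y : ℕ), y₀ ≤ y → (y : ℝ) ≤ x →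
      c * (Real.log x * Real.log y + Real.log x ^ 2 * Real.log y / y) ≤ saddlePhi₂ (saddlePoint x y) y ∧
      saddlePhi₂ (saddlePoint x y) y ≤
        C * (Real.log x * Real.log y + Real.log x ^ 2 * Real.log y / y) := by
  obtain ⟨c₁, y₁, hc₁, hy₁2, hlow⟩ := le_saddlePhi₂_saddlePoint_uniform
  obtain ⟨y₂, hy₂2, hup⟩ := exists_saddlePhi₂_saddlePoint_le_uniform
  refine ⟨min c₁ (1 / 6) / 2, 108, max y₁ y₂, by positivity, by norm_num, le_trans hy₁2 (le_max_left _ _),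
    fun x y hy hyx => ⟨?_, hup x y (le_trans (le_max_right _ _) hy) hyx⟩⟩
  have hy₁ : y₁ ≤ y := le_trans (le_max_left _ _) hy
  have hy2 : 2 ≤ y := hy₁2.trans hy₁
  have hy1 : (1 : ℝ) < y := by exact_mod_cast lt_of_lt_of_le one_lt_two hy2
  have hx1 : 1 < x := by linarith
  have hℓ : 0 < Real.log y := Real.log_pos hy1
  have hL : 0 < Real.log x := Real.log_pos hx1
  have h1 := hlow x y hy₁ hyx
  have h2 := sq_log_div_le_saddlePhi₂_saddlePoint hy2 hyx
  have hm1 : min c₁ (1 / 6) ≤ c₁ := min_le_left _ _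
  have hm2 : min c₁ (1 / 6) ≤ 1 / 6 := min_le_right _ _
  have hm0 : 0 < min c₁ (1 / 6) := lt_min hc₁ (by norm_num)
  have hA : min c₁ (1 / 6) * (Real.log x * Real.log y) ≤ saddlePhi₂ (saddlePoint x y) y :=
    le_trans (mul_le_mul_of_nonneg_right hm1 (by positivity)) h1
  have hB : min c₁ (1 / 6) * (Real.log x ^ 2 * Real.log y / y) ≤ saddlePhi₂ (saddlePoint x y) y := by
    calc min c₁ (1 / 6) * (Real.log x ^ 2 * Real.log y / y) ≤ 1 / 6 * (Real.log x ^ 2 * Real.log y / y) :=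
          mul_le_mul_of_nonneg_right hm2 (by positivity)
      _ = Real.log x ^ 2 * Real.log y / (6 * y) := by field_simp
      _ ≤ saddlePhi₂ (saddlePoint x y) y := h2
  calc min c₁ (1 / 6) / 2 * (Real.log x * Real.log y + Real.log x ^ 2 * Real.log y / y)
      = (min c₁ (1 / 6) * (Real.log x * Real.log y) + min c₁ (1 / 6) * (Real.log x ^ 2 * Real.log y / y)) / 2 := by
        ring
    _ ≤ (saddlePhi₂ (saddlePoint x y) y + saddlePhi₂ (saddlePoint x y) y) / 2 := by gcongr
    _ = saddlePhi₂ (saddlePoint x y) y := by ring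

end Literature.NumberTheory.Sieve
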